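import Mathlib
import Summits.KontsevichZagierPeriods.Zeta5Search.DenomLaw.LawA4CoverKit
import Summits.KontsevichZagierPeriods.Zeta5Search.LawA3K
import HarnessLib

/-!
# ζ(5) search — a COVER KIT for THEOREM A‴ in `𝒦`-form (`SecondOrder.lawA3K`, `6 − 2M`, `M ≥ 4`): the four class clauses from a class-type cover — DENOM-LAW prover-d1 gen 19

HONEST FRAMING: systematic search; no irrationality claim unless certified.  Cell `pub-zeta5`, track «DENOM-LAW», seat `denom-prover-d1`
gen 19 (`HOME/denom-law/prover-d1/ATTEMPT-19.md` §4).  `p`-adic valuation bookkeeping for the explicit rationals `Cas_j(b)`; nothing about ζ(5);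
no model exponent moves; records in print UNMOVED.

The A‴-analogue of gen 18's `LawA4CoverKit`: from a class-type cover of `b` (`ClassTypeCover.Cover`) and a type-level Boolean check of the FOUR
clauses H1–H4 of `SecondOrder.LawA3` (SPELLED OUT as a `List.all` — exactly the first four conjuncts of the A⁗ check / of `checkL5`; no new
definition), the class hypotheses of `lawA3K` (`lawA3Hyps_of_cover`), and the any-`j` wrappers `lawA3K_of_cover` / `cover_A3K`:
`6 − 2M ≤ v_p(Cas_j(b))` for `M ≥ 4` even, `T` a palindrome, a window prime and the DEGREE REGIME `p ≤ d(b)`.  At `M = 4` this is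
THEOREM A‴₄ (`v ≥ −2`; the census's configuration (i) = 48 % of the open instances of the ∀-`b` node at `p = 11`, K-A‴₄ blind leg HIT j274716).
-/

open Finset

namespace Summit.KontsevichZagierPeriods.Zeta5Search.DenomLaw

open Summit.KontsevichZagierPeriods.Zeta5Search.ClusterValuation
open Summit.KontsevichZagierPeriods.Zeta5Search.CasoratianValuation (InPolytope shift casoratian)
open Summit.KontsevichZagierPeriods.Zeta5Search.WedgeDictionary (dOf)
open Summit.KontsevichZagierPeriods.Zeta5Search.ClassTypeCover
open Summit.KontsevichZagierPeriods.Zeta5Search.SecondOrder (classTypeList isRaise lawA3K)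

variable {p : ℕ}

/-- **The four A‴ clauses of `b` from a cover**: if every residue is a typed level class of a type in `TY` and, on the list (spelled-out
`List.all`, the first four conjuncts of `DenomLaw.checkL5`; no new definition), every multipole type has `E ≥ −M`, singles `ν ≥ −M+1`,
multipole types of exponent `−M` are centre-free with list `T`, pole types with `ν = −M+1` are single raises of `T` or the odd-centre type `T` —
then the hypotheses H1–H4 of `SecondOrder.LawA3` / `lawA3K` hold for `b`. -/
theorem lawA3Hyps_of_cover [Fact p.Prime] {b : ℕ → ℤ} {TY : List (List ℤ × Bool)} (hcov : Cover b p TY) {M : ℕ} {T : List ℤ}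
    (hchk : ((TY.all fun tc =>
      (decide (polesL tc.1 < 2) || decide (-(M : ℤ) ≤ expL (decide (¬ (2 : ℤ) ∣ b 0)) tc.1 tc.2)) &&
      (!decide (polesL tc.1 = 1) || decide (-(M : ℤ) + 1 ≤ nuL (decide (¬ (2 : ℤ) ∣ b 0)) tc.1 tc.2)) &&
      (!(decide (2 ≤ polesL tc.1) && decide (expL (decide (¬ (2 : ℤ) ∣ b 0)) tc.1 tc.2 = -(M : ℤ))) || (!tc.2 && decide (tc.1 = T))) &&
      (!(decide (1 ≤ polesL tc.1) && decide (nuL (decide (¬ (2 : ℤ) ∣ b 0)) tc.1 tc.2 = -(M : ℤ) + 1)) ||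
        (isRaise T tc.1 || (decide (¬ (2 : ℤ) ∣ b 0) && tc.2 && decide (tc.1 = T))))) = true)) :
    (∀ x ∈ multipoleClasses b p, -(M : ℤ) ≤ classExp b p x) ∧
    (∀ y, y < p → classPoleCount b p y = 1 → -(M : ℤ) + 1 ≤ classNu b p y) ∧
    (∀ x ∈ multipoleClasses b p, classExp b p x = -(M : ℤ) → ¬ CentreIn b p x ∧ classTypeList b p x = T) ∧
    (∀ y, y < p → 1 ≤ classPoleCount b p y → classNu b p y = -(M : ℤ) + 1 →
      isRaise T (classTypeList b p y) = true ∨ (¬ (2 : ℤ) ∣ b 0 ∧ CentreIn b p y ∧ classTypeList b p y = T)) := by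
  rw [List.all_eq_true] at hchk
  refine ⟨?_, ?_, ?_, ?_⟩
  · intro x hxm
    obtain ⟨hx, h2⟩ := (mem_multipoleClasses_iff b p x).1 hxm
    obtain ⟨tc, htc, ht⟩ := hcov x hx
    have hc := hchk tc htc
    simp only [Bool.and_eq_true, Bool.or_eq_true, decide_eq_true_eq] at hc
    rw [ht.classPoleCount_eq] at h2
    rw [ht.classExp_eq]
    rcases hc.1.1.1 with h | h
    · omega
    · exact h
  · intro y hy h1
    obtain ⟨tc, htc, ht⟩ := hcov y hy
    have hc := hchk tc htc
    simp only [Bool.and_eq_true, Bool.or_eq_true, Bool.not_eq_true', decide_eq_false_iff_not, decide_eq_true_eq] at hc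
    rw [ht.classPoleCount_eq] at h1
    rw [ht.classNu_eq]
    rcases hc.1.1.2 with h | h
    · exact absurd h1 h
    · exact h
  · intro x hxm hE
    obtain ⟨hx, h2⟩ := (mem_multipoleClasses_iff b p x).1 hxm
    obtain ⟨tc, htc, ht⟩ := hcov x hx
    have hc := hchk tc htc
    simp only [Bool.and_eq_true, Bool.or_eq_true, Bool.not_eq_true', Bool.and_eq_false_iff, decide_eq_false_iff_not,
      decide_eq_true_eq] at hc
    rw [ht.classPoleCount_eq] at h2
    rw [ht.classExp_eq] at hE
    rcases hc.1.2 with (h | h) | ⟨hc1, hc2⟩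
    · omega
    · exact absurd hE h
    · refine ⟨fun hcen => ?_, by rw [ht.classTypeList_eq]; exact hc2⟩
      rw [ht.cen_iff.1 hcen] at hc1
      exact Bool.noConfusion hc1
  · intro y hy h1 hnu
    obtain ⟨tc, htc, ht⟩ := hcov y hy
    have hc := hchk tc htc
    simp only [Bool.and_eq_true, Bool.or_eq_true, Bool.not_eq_true', Bool.and_eq_false_iff, decide_eq_false_iff_not,
      decide_eq_true_eq] at hc
    rw [ht.classPoleCount_eq] at h1
    rw [ht.classNu_eq] at hnu
    rcases hc.2 with (h | h) | (h | ⟨⟨ho, hc1⟩, hc2⟩)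
    · omega
    · exact absurd hnu h
    · left; rw [ht.classTypeList_eq]; exact h
    · right
      exact ⟨ho, ht.cen_iff.2 hc1, by rw [ht.classTypeList_eq]; exact hc2⟩

/-- **THEOREM A‴ (𝒦-form) from a cover of `b` alone**: `6 − 2M ≤ v_p(Cas_j(b))` (`M ≥ 4` even, `T` a palindrome, `5 ≤ p ≤ b₀ < p² − 2`,
degree regime `p ≤ d(b)`). -/
theorem lawA3K_of_cover {b : ℕ → ℤ} {j : ℕ} (hb : InPolytope b) (hb' : InPolytope (shift b j)) (hj1 : 1 ≤ j) (hj7 : j ≤ 7)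
    (hpr : p.Prime) (hp5 : 5 ≤ p) (hpb : (p : ℤ) ≤ b 0) (hwin : (b 0 + 2 : ℤ) < (p : ℤ) ^ 2) (hpd : (p : ℤ) ≤ dOf b)
    {TY : List (List ℤ × Bool)} (hcov : Cover b p TY) {M : ℕ} (hM : 4 ≤ M) (hMe : Even M) {T : List ℤ} (hT : T.reverse = T)
    (hchk : ((TY.all fun tc =>
      (decide (polesL tc.1 < 2) || decide (-(M : ℤ) ≤ expL (decide (¬ (2 : ℤ) ∣ b 0)) tc.1 tc.2)) &&
      (!decide (polesL tc.1 = 1) || decide (-(M : ℤ) + 1 ≤ nuL (decide (¬ (2 : ℤ) ∣ b 0)) tc.1 tc.2)) &&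
      (!(decide (2 ≤ polesL tc.1) && decide (expL (decide (¬ (2 : ℤ) ∣ b 0)) tc.1 tc.2 = -(M : ℤ))) || (!tc.2 && decide (tc.1 = T))) &&
      (!(decide (1 ≤ polesL tc.1) && decide (nuL (decide (¬ (2 : ℤ) ∣ b 0)) tc.1 tc.2 = -(M : ℤ) + 1)) ||
        (isRaise T tc.1 || (decide (¬ (2 : ℤ) ∣ b 0) && tc.2 && decide (tc.1 = T))))) = true)) (hcas : casoratian b j ≠ 0) :
    (6 : ℤ) - 2 * M ≤ padicValRat p (casoratian b j) := by
  haveI : Fact p.Prime := ⟨hpr⟩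
  obtain ⟨H1, H2, H3, H4⟩ := lawA3Hyps_of_cover hcov hchk
  exact lawA3K b p j M T hb hb' hj1 hj7 hpr hp5 hpb hwin hpd hM hMe hT H1 H2 H3 H4 hcas

/-- **WINDOW BOUND by THEOREM A‴ (𝒦-form) from a cover**: `c ≤ v_p(Cas_j(b))` whenever `c ≤ 6 − 2M`. -/
theorem cover_A3K {b : ℕ → ℤ} {j : ℕ} (hb : InPolytope b) (hb' : InPolytope (shift b j)) (hj1 : 1 ≤ j) (hj7 : j ≤ 7)
    (hpr : p.Prime) (hp5 : 5 ≤ p) (hpb : (p : ℤ) ≤ b 0) (hwin : (b 0 + 2 : ℤ) < (p : ℤ) ^ 2) (hpd : (p : ℤ) ≤ dOf b)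
    {TY : List (List ℤ × Bool)} (hcov : Cover b p TY) {M : ℕ} (hM : 4 ≤ M) (hMe : Even M) {T : List ℤ} (hT : T.reverse = T)
    (hchk : ((TY.all fun tc =>
      (decide (polesL tc.1 < 2) || decide (-(M : ℤ) ≤ expL (decide (¬ (2 : ℤ) ∣ b 0)) tc.1 tc.2)) &&
      (!decide (polesL tc.1 = 1) || decide (-(M : ℤ) + 1 ≤ nuL (decide (¬ (2 : ℤ) ∣ b 0)) tc.1 tc.2)) &&
      (!(decide (2 ≤ polesL tc.1) && decide (expL (decide (¬ (2 : ℤ) ∣ b 0)) tc.1 tc.2 = -(M : ℤ))) || (!tc.2 && decide (tc.1 = T))) &&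
      (!(decide (1 ≤ polesL tc.1) && decide (nuL (decide (¬ (2 : ℤ) ∣ b 0)) tc.1 tc.2 = -(M : ℤ) + 1)) ||
        (isRaise T tc.1 || (decide (¬ (2 : ℤ) ∣ b 0) && tc.2 && decide (tc.1 = T))))) = true)) {c : ℤ} (hc : c ≤ 6 - 2 * (M : ℤ))
    (hcas : casoratian b j ≠ 0) : c ≤ padicValRat p (casoratian b j) :=
  le_trans hc (lawA3K_of_cover hb hb' hj1 hj7 hpr hp5 hpb hwin hpd hcov hM hMe hT hchk hcas)

/-- Sanity of the spelled-out check at `M = 4`: the census example `b = (40; 18,18,18,14,14,13,13)`, `p = 11` (`v₁₁(Cas₇) = −2`) has the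
class types below (deep pair `[1,−3,−3,1]`, tame singles, multipoles at `E = −2`), and they pass the four clauses at `(4, [1,−3,−3,1])`. -/
example : (([([1, 1, -6, 1], false), ([1, 1, -3, 1], false), ([1, -1, -3, 1], false), ([1, -3, -3, 1], false), ([1, -3, -1, 1], false),
    ([1, -3, 1, 1], false), ([1, -6, 1, 1], false), ([1, -6, 1], false), ([1, -5, 1], true)] : List (List ℤ × Bool)).all fun tc =>
      (decide (polesL tc.1 < 2) || decide (-((4 : ℕ) : ℤ) ≤ expL false tc.1 tc.2)) &&
      (!decide (polesL tc.1 = 1) || decide (-((4 : ℕ) : ℤ) + 1 ≤ nuL false tc.1 tc.2)) &&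
      (!(decide (2 ≤ polesL tc.1) && decide (expL false tc.1 tc.2 = -((4 : ℕ) : ℤ))) || (!tc.2 && decide (tc.1 = [1, -3, -3, 1]))) &&
      (!(decide (1 ≤ polesL tc.1) && decide (nuL false tc.1 tc.2 = -((4 : ℕ) : ℤ) + 1)) ||
        (isRaise [1, -3, -3, 1] tc.1 || (false && tc.2 && decide (tc.1 = [1, -3, -3, 1]))))) = true := by decide

end Summit.KontsevichZagierPeriods.Zeta5Search.DenomLaw
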